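import Mathlib
import Summits.Ventures.HodgeRepro.OcticCMPointGaloisRing16

/-!
# OcticCMPointGaloisRing16Prim — the primitive `σ`-odd additive character `ψ̃_δ = ψ₁₆ ∘ tr ∘ (δ ·)` of `GR(16, 4)`

Blind re-derivation cell `pub-hodge-repro`, seat night-2 (gen 5).  Target tree path
`lean/Summits/Ventures/HodgeRepro/OcticCMPointGaloisRing16Prim.lean`.  On `GR(16, 4) = 𝒪/𝔮⁴` of
`OcticCMPointGaloisRing16.lean` (trace `tr`, trace-zero unit `δ`):

* `psi16 = e(x/16)` (`ζ₁₆` a primitive `16`-th root of unity), **`psiTildeGR16 = ψ₁₆ ∘ tr ∘ (δ ·)`** — the additive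
  character of the route's shape `ψ_δ(x) = ψ(Tr(δ x))`, with **`ψ̃_δ ∘ σ = ψ̃_δ ∘ (−1 ·)`** (`psiTildeGR16_conjGR`) and
  **`ψ̃_δ(t) = 1` for every `σ`-fixed `t`** (`psiTildeGR16_eq_one_of_conjGR_fixed`: the Frobenius sum of `δ t`
  telescopes since `σ(δ t) = −δ t`);
* **`psiTildeGR16_isPrimitive`**: the Gram matrix `G = !![0,6,0,7; 6,0,7,10; 0,7,10,0; 7,10,0,15]` of `(a, b) ↦ tr(δ a b)`
  in the power basis is invertible over `ℤ/16` (`G H = 1`), so the vector `(tr(δ a r^j))_j = (coords a) ⬝ G` vanishes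
  only for `a = 0`; `mulShift_psiTildeGR16_injective`.

**What this is not.**  The ideal `4GR` of the stationary phase and the conductor-`4` root numbers are in
`OcticCMPointGaloisRing16Ideal.lean` / `OcticCMPointGaloisRing16Sign.lean`.  Nothing here says anything about the
status of the Hodge conjecture for CM abelian varieties, which is NOT proved.
-/

set_option autoImplicit false

noncomputable section

open Polynomial Matrix

namespace Summit.Ventures.HodgeRepro.PeriodCloser

namespace GaloisRing16

/-! ### The additive character `ψ̃_δ = ψ₁₆ ∘ tr ∘ (δ ·)` -/

/-- A primitive `16`-th root of unity `ζ₁₆ = e(1/16)`. -/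
def ζ16 : ℂ := Complex.exp (2 * Real.pi * Complex.I / 16)

/-- `ζ₁₆` is a primitive `16`-th root of unity. -/
theorem ζ16_isPrimitiveRoot : IsPrimitiveRoot ζ16 16 := Complex.isPrimitiveRoot_exp 16 (by norm_num)

/-- The standard character `ψ₁₆(x) = ζ₁₆^x` of `ℤ/16`. -/
def psi16 : AddChar (ZMod 16) ℂ :=
  AddChar.zmodChar 16 ((IsPrimitiveRoot.iff_def ζ16 16).mp ζ16_isPrimitiveRoot).left

/-- `ψ₁₆ t = 1 ↔ t = 0`. -/
theorem psi16_eq_one_iff (t : ZMod 16) : psi16 t = 1 ↔ t = 0 := by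
  rw [psi16, AddChar.zmodChar_apply, ζ16_isPrimitiveRoot.pow_eq_one_iff_dvd, ← ZMod.val_eq_zero]
  constructor
  · intro h
    exact Nat.eq_zero_of_dvd_of_lt h (ZMod.val_lt t)
  · intro h
    rw [h]
    exact dvd_zero 16

/-- `tr (δ ·)` as an additive map. -/
def trDelta : GR164 →+ ZMod 16 where
  toFun y := tr (delta * y)
  map_zero' := by
    show tr (delta * 0) = 0
    rw [mul_zero]; unfold tr; exact map_zero trL
  map_add' y z := by
    show tr (delta * (y + z)) = tr (delta * y) + tr (delta * z)
    rw [mul_add, tr_add]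

/-- **The additive character `ψ̃_δ(y) = ψ₁₆(tr(δ y))`** of `GR(16, 4)`. -/
def psiTildeGR16 : AddChar GR164 ℂ := psi16.compAddMonoidHom trDelta

/-- `ψ̃_δ(y) = ψ₁₆(tr(δ y))`. -/
theorem psiTildeGR16_apply (y : GR164) : psiTildeGR16 y = psi16 (tr (delta * y)) := rfl

/-- **`ψ̃_δ ∘ σ = ψ̃_δ ∘ (−1 ·)`**: `δ σ(y) = −σ(δ y)` and `tr ∘ σ = tr`. -/
theorem psiTildeGR16_conjGR (y : GR164) : psiTildeGR16 (conjGR y) = psiTildeGR16 (-y) := by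
  rw [psiTildeGR16_apply, psiTildeGR16_apply]
  congr 1
  have h : delta * conjGR y = -(conjGR (delta * y)) := by
    rw [map_mul, conjGR_delta]; ring
  rw [h, tr_neg, tr_conjGR, mul_neg, tr_neg]

/-- **`tr(δ t) = 0` for every `σ`-fixed `t`** (the Frobenius sum of `δ t` telescopes: `σ(δ t) = −δ t`). -/
theorem tr_delta_mul_eq_zero_of_conjGR_fixed {t : GR164} (ht : conjGR t = t) : tr (delta * t) = 0 := by
  apply algebraMap_injective
  rw [← frobSum_eq_tr, map_zero]
  have hσ : conjGR (delta * t) = -(delta * t) := by rw [map_mul, conjGR_delta, ht, neg_mul]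
  have h2 : frobLift (frobLift (delta * t)) = -(delta * t) := by rw [frobLift_frobLift, hσ]
  have h3 : frobLift (frobLift (frobLift (delta * t))) = -(frobLift (delta * t)) := by rw [h2, map_neg]
  rw [h3, h2]
  ring

/-- `ψ̃_δ(t) = 1` for every `σ`-fixed `t`. -/
theorem psiTildeGR16_eq_one_of_conjGR_fixed {t : GR164} (ht : conjGR t = t) : psiTildeGR16 t = 1 := by
  rw [psiTildeGR16_apply, tr_delta_mul_eq_zero_of_conjGR_fixed ht]
  exact AddChar.map_zero_eq_one psi16


/-! ### The values `tr(δ r^k)`, `k ≤ 6`, the Gram matrix, and the primitivity of `ψ̃_δ` -/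

/-- **The seven values `tr(δ r^k)`, `k = 0, …, 6`**: `0, 6, 0, 7, 10, 0, 15` (the coordinates of `δ r^k` are explicit
`linear_combination`s of the relation and `16 = 0`; `numerics/gr164_certs2.py`). -/
theorem tr_delta_pow (k : ℕ) (hk : k ≤ 6) :
    tr (delta * r ^ k) = ![0, 6, 0, 7, 10, 0, 15] ⟨k, by omega⟩ := by
  have hrel := r_rel
  have h16 := sixteen_eq_zero
  have h2 : algebraMap (ZMod 16) GR164 2 = 2 := map_ofNat _ _
  have h4 : algebraMap (ZMod 16) GR164 4 = 4 := map_ofNat _ _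
  have h5 : algebraMap (ZMod 16) GR164 5 = 5 := map_ofNat _ _
  have h6 : algebraMap (ZMod 16) GR164 6 = 6 := map_ofNat _ _
  have h7 : algebraMap (ZMod 16) GR164 7 = 7 := map_ofNat _ _
  have h8 : algebraMap (ZMod 16) GR164 8 = 8 := map_ofNat _ _
  have h9 : algebraMap (ZMod 16) GR164 9 = 9 := map_ofNat _ _
  have h10 : algebraMap (ZMod 16) GR164 10 = 10 := map_ofNat _ _
  have h12 : algebraMap (ZMod 16) GR164 12 = 12 := map_ofNat _ _
  have h13 : algebraMap (ZMod 16) GR164 13 = 13 := map_ofNat _ _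
  have h14 : algebraMap (ZMod 16) GR164 14 = 14 := map_ofNat _ _
  interval_cases k
  · rw [show delta * r ^ 0 = (1 : ZMod 16) • (1 : GR164) + (4 : ZMod 16) • r + (14 : ZMod 16) • r ^ 2 + (12 : ZMod 16) • r ^ 3 by
      simp only [smul_eq_num, h4, h12, h14, map_one]; unfold delta; ring]
    rw [tr_comb]; rfl
  · rw [show delta * r ^ 1 = (4 : ZMod 16) • (1 : GR164) + (13 : ZMod 16) • r + (12 : ZMod 16) • r ^ 2 + (14 : ZMod 16) • r ^ 3 by
      simp only [smul_eq_num, h4, h12, h13, h14]; unfold delta; linear_combination ((12 : GR164)) * hrel + ((-1 : GR164) + (-3 : GR164) * r + (-11 : GR164) * r ^ 2 + (-9 : GR164) * r ^ 3) * h16]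
    rw [tr_comb]; rfl
  · rw [show delta * r ^ 2 = (2 : ZMod 16) • (1 : GR164) + (10 : ZMod 16) • r + (9 : ZMod 16) • r ^ 2 + (4 : ZMod 16) • r ^ 3 by
      simp only [smul_eq_num, h2, h4, h9, h10]; unfold delta; linear_combination ((-130 : GR164) + (12 : GR164) * r) * hrel + ((8 : GR164) + (23 : GR164) * r + (111 : GR164) * r ^ 2 + (87 : GR164) * r ^ 3) * h16]
    rw [tr_comb]; rfl
  · rw [show delta * r ^ 3 = (12 : ZMod 16) • (1 : GR164) + (6 : ZMod 16) • r + (2 : ZMod 16) • r ^ 2 + (9 : ZMod 16) • r ^ 3 by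
      simp only [smul_eq_num, h2, h6, h9, h12]; unfold delta; linear_combination ((1396 : GR164) + (-130 : GR164) * r + (12 : GR164) * r ^ 2) * hrel + ((-88 : GR164) + (-254 : GR164) * r + (-1198 : GR164) * r ^ 2 + (-936 : GR164) * r ^ 3) * h16]
    rw [tr_comb]; rfl
  · rw [show delta * r ^ 4 = (7 : ZMod 16) • (1 : GR164) + (1 : ZMod 16) • r + (8 : ZMod 16) • r ^ 2 + (6 : ZMod 16) • r ^ 3 by
      simp only [smul_eq_num, h6, h7, h8, map_one]; unfold delta; linear_combination ((-14967 : GR164) + (1396 : GR164) * r + (-130 : GR164) * r ^ 2 + (12 : GR164) * r ^ 3) * hrel + ((935 : GR164) + (2719 : GR164) * r + (12842 : GR164) * r ^ 2 + (10027 : GR164) * r ^ 3) * h16]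
    rw [tr_comb]; rfl
  · rw [show delta * r ^ 5 = (10 : ZMod 16) • (1 : GR164) + (5 : ZMod 16) • r + (13 : ZMod 16) • r ^ 2 + (0 : ZMod 16) • r ^ 3 by
      simp only [smul_eq_num, h5, h10, h13, map_zero]; unfold delta; linear_combination ((160438 : GR164) + (-14967 : GR164) * r + (1396 : GR164) * r ^ 2 + (-130 : GR164) * r ^ 3 + (12 : GR164) * r ^ 4) * hrel + ((-10028 : GR164) + (-29147 : GR164) * r + (-137665 : GR164) * r ^ 2 + (-107486 : GR164) * r ^ 3) * h16]
    rw [tr_comb]; rfl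
  · rw [show delta * r ^ 6 = (0 : ZMod 16) • (1 : GR164) + (10 : ZMod 16) • r + (5 : ZMod 16) • r ^ 2 + (13 : ZMod 16) • r ^ 3 by
      simp only [smul_eq_num, h5, h10, h13, map_zero]; unfold delta; linear_combination ((-1719776 : GR164) + (160438 : GR164) * r + (-14967 : GR164) * r ^ 2 + (1396 : GR164) * r ^ 3 + (-130 : GR164) * r ^ 4 + (12 : GR164) * r ^ 5) * hrel + ((107486 : GR164) + (312430 : GR164) * r + (1475657 : GR164) * r ^ 2 + (1152167 : GR164) * r ^ 3) * h16]
    rw [tr_comb]; rfl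

/-- The Gram matrix `G i j = tr(δ r^i r^j)`. -/
def G : Matrix (Fin 4) (Fin 4) (ZMod 16) := !![0, 6, 0, 7; 6, 0, 7, 10; 0, 7, 10, 0; 7, 10, 0, 15]

/-- The inverse of `G` over `ℤ/16`. -/
def H : Matrix (Fin 4) (Fin 4) (ZMod 16) := !![1, 8, 12, 7; 8, 6, 15, 4; 12, 15, 12, 10; 7, 4, 10, 8]

/-- **`G * H = 1`**. -/
theorem G_mul_H : G * H = 1 := by
  ext i j
  fin_cases i <;> fin_cases j <;> simp [G, H, Matrix.mul_apply, Fin.sum_univ_four] <;> decide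

/-- `G` is the Gram matrix: `tr(δ r^i r^j) = G i j`. -/
theorem tr_delta_mul (i j : Fin 4) : tr (delta * r ^ (i : ℕ) * r ^ (j : ℕ)) = G i j := by
  rw [mul_assoc, ← pow_add, tr_delta_pow _ (by omega)]
  fin_cases i <;> fin_cases j <;> rfl

/-- `tr(δ a r^j) = Σ_i (coords a)_i · G i j`. -/
theorem tr_delta_mul_eq_vecMul (a : GR164) (j : Fin 4) :
    tr (delta * a * r ^ (j : ℕ)) = Matrix.vecMul (⇑(b4.repr a)) G j := by
  conv_lhs => rw [← b4.sum_repr a]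
  simp only [b4_apply, Finset.mul_sum, Finset.sum_mul, mul_smul_comm, smul_mul_assoc]
  show trL _ = _
  rw [map_sum]
  simp only [map_smul, smul_eq_mul]
  rw [Matrix.vecMul, dotProduct]
  refine Finset.sum_congr rfl fun i _ => ?_
  rw [show trL (delta * r ^ (i : ℕ) * r ^ (j : ℕ)) = tr (delta * r ^ (i : ℕ) * r ^ (j : ℕ)) from rfl, tr_delta_mul]

/-- **The trace form is non-degenerate**: `a ≠ 0 → ∃ j, tr(δ a r^j) ≠ 0`. -/
theorem exists_tr_delta_ne_zero {a : GR164} (ha : a ≠ 0) : ∃ j : Fin 4, tr (delta * a * r ^ (j : ℕ)) ≠ 0 := by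
  by_contra hcon
  have hcon' : ∀ j : Fin 4, tr (delta * a * r ^ (j : ℕ)) = 0 := fun j => by
    by_contra hj
    exact hcon ⟨j, hj⟩
  have hv : Matrix.vecMul (⇑(b4.repr a)) G = 0 := by
    funext j
    rw [← tr_delta_mul_eq_vecMul, hcon' j]
    rfl
  have hc : ⇑(b4.repr a) = 0 := by
    calc ⇑(b4.repr a) = Matrix.vecMul (⇑(b4.repr a)) 1 := (Matrix.vecMul_one _).symm
      _ = Matrix.vecMul (⇑(b4.repr a)) (G * H) := by rw [G_mul_H]
      _ = Matrix.vecMul (Matrix.vecMul (⇑(b4.repr a)) G) H := (Matrix.vecMul_vecMul _ _ _).symm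
      _ = 0 := by rw [hv, Matrix.zero_vecMul]
  apply ha
  have : b4.repr a = 0 := DFunLike.coe_injective hc
  exact b4.repr.injective (by rw [this, map_zero])

/-- **`ψ̃_δ` is primitive**. -/
theorem psiTildeGR16_isPrimitive : psiTildeGR16.IsPrimitive := by
  intro a ha h1
  obtain ⟨j, hj⟩ := exists_tr_delta_ne_zero ha
  have := DFunLike.congr_fun h1 (r ^ (j : ℕ))
  rw [AddChar.mulShift_apply, AddChar.one_apply, psiTildeGR16_apply, psi16_eq_one_iff, ← mul_assoc] at this
  exact hj this

/-- `ψ̃_δ(a ·) = ψ̃_δ(b ·)` forces `a = b`. -/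
theorem mulShift_psiTildeGR16_injective {a b : GR164}
    (h : AddChar.mulShift psiTildeGR16 a = AddChar.mulShift psiTildeGR16 b) : a = b := by
  by_contra hne
  apply psiTildeGR16_isPrimitive (sub_ne_zero.2 hne)
  have : AddChar.mulShift psiTildeGR16 (a - b) =
      AddChar.mulShift psiTildeGR16 a * AddChar.mulShift psiTildeGR16 (-b) := by
    rw [AddChar.mulShift_mul, sub_eq_add_neg]
  rw [this, h, AddChar.mulShift_mul, add_neg_cancel, AddChar.mulShift_zero]

end GaloisRing16

end Summit.Ventures.HodgeRepro.PeriodCloser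

end
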